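/-
Origin: expansion seat `prover-pub-hodgecm-mc-binder-1-g16-0`, handover #R112 2026-08-20T20:49:35Z md5 6d038808799f (69 l.; NEW additive MODEL leaf; imports HodgeCM.Model.TowerCarrier (#R109, RUN 62) only; drops ⇒ {#R113}; NAMES for audit: HodgeCM.Model.TowerCarrier.of_smul_eq_act · HodgeCM.Model.TowerCarrier.of_smul_ofLevel; all decls: HodgeCM.Model.TowerCarrier.instModuleMonoidAlgebraTower · HodgeCM.Model.TowerCarrier.monoidAlgebra_smul_def · HodgeCM.Model.TowerCarrier.of_smul_eq_act · HodgeCM.Model.TowerCarrier.instIsScalarTowerTower · HodgeCM.Model.TowerCarrier.of_smul_ofLevel) (`HOME/mc/pub-hodgecm-mc-binder-1-g16/stage63/HodgeCM/Model/TowerAlgebra.lean`, md5 6d038808799f, 69 lines);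
landed by the gen-26 packager (p-g26) in gate run 63 as `HodgeCM/Model/TowerAlgebra.lean` (verbatim).
-/
/-
Copyright (c) 2026 the pub-hodgecm formalisation cell (harness21).  New file, not vendored.
Origin: session prover-pub-hodgecm-mc-binder-1-g16-0 (unit pub-hodgecm-mc-binder-1-g16, BINDER PROVER gen 16 of lineage mc-binder-1;
content lane (J-Liu-Θ), (J3) HECKE-TOWER — the `ℂ[U(V)(𝔸_f)]`-module structure on the tower type ITSELF), 2026-08-20.
-/
import Summits.HodgeConjecture.HodgeCM.Model.TowerCarrier

/-!
# The `ℂ[U(V)(𝔸_{L₀,f})]`-module structure on the tower type `Tower … V` itself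

#R109 packaged the action as `towerRep : Representation ℂ V.adelicFin (Tower … V)` and the module as Mathlib's synonym
`TowerModule := towerRep.asModule`.  Downstream (the dictionary `Model/LiuDictionary`, RUN 62), the carrier `H` must come with
FOUR COHERENT instances `AddCommGroup H`, `Module ℂ H`, `Module (MonoidAlgebra ℂ V.adelicFin) H`, `IsScalarTower`; on the synonym,
instance search does not recover the direct limit's `AddCommGroup` (the family `HK` blocks the nested unification), so we put the
group-algebra structure on `Tower … V` directly, next to `Module.DirectLimit`'s own `AddCommGroup`/`Module ℂ`:

* `instance : Module (MonoidAlgebra ℂ V.adelicFin) (Tower … V)` (`Module.compHom` through `towerRep.asAlgebraHom` — the very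
  definition of `Representation.asModule`'s instance) and `instance : IsScalarTower ℂ (MonoidAlgebra ℂ V.adelicFin) (Tower … V)`;
* `of_smul_eq_act : MonoidAlgebra.of ℂ _ g • x = act g x`, and `of_smul_ofLevel : k ∈ Γ.K → of k • ofLevel Γ c = ofLevel Γ c`
  (the images of the finite levels are `K`-fixed).
-/

noncomputable section

open Function Set
open NumberField
open Literature.AlgebraicGeometry.HodgeTheory
open Literature.NumberTheory.Automorphic
open Literature.NumberTheory.Automorphic.PicardCM
open Literature.NumberTheory.Transcendental (Arapura2012_Cor_15_4_6)

namespace HodgeCM.Model.TowerCarrier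

open HodgeCM.Model.TowerLevel

variable (hHD : exists_isReal_hodgeModel) (hI : hodgePQ_independent_of_hodgeModel)
  (hU : BallQuotientUniformisedDatum) (h₃ : CMAbelianVarietyRealised) (hA : Arapura2012_Cor_15_4_6)
variable {L : CMField} {ι₁ : L →+* ℂ} (V : HermSpace3 L ι₁)

/-- **`Tower … V` as a `ℂ[U(V)(𝔸_{L₀,f})]`-module**: `r • x := towerRep.asAlgebraHom r x`. -/
instance instModuleMonoidAlgebraTower : Module (MonoidAlgebra ℂ ↥V.adelicFin) (Tower hHD hI hU h₃ hA V) :=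
  Module.compHom (Tower hHD hI hU h₃ hA V) (towerRep hHD hI hU h₃ hA V).asAlgebraHom.toRingHom

variable {V}

/-- (Ported verbatim from the HodgeCMPerL package; no docstring in the source.) -/
theorem monoidAlgebra_smul_def (r : MonoidAlgebra ℂ ↥V.adelicFin) (x : Tower hHD hI hU h₃ hA V) :
    r • x = (towerRep hHD hI hU h₃ hA V).asAlgebraHom r x := rfl

/-- The group element `g` acts through `of g` by `act g`. -/
theorem of_smul_eq_act (g : V.adelicFin) (x : Tower hHD hI hU h₃ hA V) :
    MonoidAlgebra.of ℂ ↥V.adelicFin g • x = act hHD hI hU h₃ hA g x := by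
  rw [monoidAlgebra_smul_def, Representation.asAlgebraHom_of]
  rfl

variable (V) in
/-- `ℂ` and `ℂ[U(V)(𝔸_f)]` act compatibly. -/
instance instIsScalarTowerTower : IsScalarTower ℂ (MonoidAlgebra ℂ ↥V.adelicFin) (Tower hHD hI hU h₃ hA V) :=
  ⟨fun t r x ↦ by rw [monoidAlgebra_smul_def, monoidAlgebra_smul_def, map_smul, LinearMap.smul_apply]⟩

/-- **The image of `H_K` consists of `K`-fixed vectors** (module form on `Tower`). -/
theorem of_smul_ofLevel {Γ : Level V} (hΓ : Γ.BelowConjThree) {k : V.adelicFin} (hk : k ∈ Γ.K)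
    (c : towerLevel hHD hI hU h₃ hA Γ hΓ) :
    MonoidAlgebra.of ℂ ↥V.adelicFin k • ofLevel hHD hI hU h₃ hA Γ hΓ c = ofLevel hHD hI hU h₃ hA Γ hΓ c := by
  rw [of_smul_eq_act]
  exact act_ofLevel_of_mem hHD hI hU h₃ hA hΓ hk c

end HodgeCM.Model.TowerCarrier

end
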